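import Literature.Probability.FitznerVanDerHofstad2017.NobleBoundsN1IotaCls12
import Literature.Probability.FitznerVanDerHofstad2017.NobleJointTwoLevelIotaKitB1
import HarnessLib

/-!
# Fitzner–van der Hofstad (2017), §6.1: the class `(a,b) = (1,1)` of (6.4) at `N = 1` for the `ι`-event

[FvdH17] = R. Fitzner, R. van der Hofstad, *Mean-field behavior for nearest-neighbor percolation in `d > 10`*,
Electron. J. Probab. **22** (2017), no. 43, arXiv:1506.07977v2; §6.1 proof of Lemma 5.3 (pp. 58–59):
"Case `a = 1`" of the `Ξ^ι` start ("`u` and `w` are neighbors"), "`b = 1`: … `z` and `t` are connected by one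
direct bond … the factor `p⁻¹` includes the information that `z` and `t` are neighbors"; App. B rows `b = 1` of
`P^{ι,b}` (p. 73), `Ā^{ι,1,1} = p⁻¹ 2dD(w−u) S_{1̲,0,1̲,0}(e_ι, t−u, z−u, w−u)` (pp. 75, 78), `P^{E,1} = T_{1,1̲,1}`.

The class estimate `h2 (1,1)` of `NobleBoundsN1IotaReduce.tsum_ofReal_nobleXiIotaN_one_le_of_cls₁₂` for the event
`E ι x = NobleJointTwoLevelIota.jointWitIota ι x`:
`J(v−u) ℙ_p^{⊗2}(jointWitIota ∩ class (1,1)) ≤ Σ_κ 𝟙{v = u+e_κ} P^{ι,1}(u,w) Ā'^{κ,1,1}(u,w,t,z) P^{E,1}(t−x,z−x)`.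
DOUBLY absorbed style (`NobleJointTwoLevelIotaKitB1`, after `NobleBoundsN1Cls11` for the plain joint event):
`p = J(v−u)` becomes the open bond `b₀ = (u,v)` at level `0` (line `{u ←1̲→ v}₀`), a second factor `p` —
compensated by the `p⁻¹` of `Ā^{κ,1,1}` — becomes the line `{t ←1̲→ z}₀` of `S_{1̲,0,1̲,0}` witnessed by the
bond `(t,z)` on level `0` (the event does not read that coordinate: its level-`0` witnesses avoid `(t,z)`), and
the level-`1` witnesses are re-routed onto the open bond `(t,z)` (line `{t ←1̲→ z}₁` of `P^{E,1}`).  The level-`0`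
treatment of class `a = 1` (re-routing onto the open bond `(u,w)`, `NobleRerouteJointWitIota`; start rows
`one_base` / `one_eq` / `one_ne` of `NobleBoundsN1IotaStart`; the line families `IotaCls12.l0B/l0Iw/l0Ie`) is
that of the class `(1,2)` (`NobleBoundsN1IotaCls12`).  Off-lattice class bonds give null classes.
Unconditional, every `d` and `p`.
-/

namespace Literature.Probability.FitznerVanDerHofstad2017

open Literature.Barriers.CriticalPhenomena Literature.Probability.Percolation Literature.Probability.LatticeModels
open Literature.Combinatorics.SimpleGraph _root_.SimpleGraph _root_.MeasureTheory
open Literature.Probability.FitznerVanDerHofstad2017.NobleBlocks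
open Literature.Probability.FitznerVanDerHofstad2017.NobleBlocks.LenIdx
open scoped ENNReal BigOperators

variable {d : ℕ}

namespace IotaCls11

/-- On `jointWitIota ∩ class (1,1)`: the side conditions, the open bond `(u,w)` on level `0` (`u ≠ w`), the open
bond `(t,z)` on level `1` (`t ≠ z`), and `z, t ≠ x`.
[cite: FitznerVanDerHofstad2017, §6.1 "Case a = 1", "b = 1" (arXiv:1506.07977v2 p. 59)] -/
theorem facts {ι : Fin d × Bool} {x u v w z t : Site d} {ω : Fin 2 → BondConfig (Site d)}
    (hω : ω ∈ jointWitIota ι x u v w z t ∩ clsSet u w t z 1 1) :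
    JWιSide u v w z t x ∧ (u ≠ w ∧ s(u, w) ∈ ω 0) ∧ (t ≠ z ∧ s(t, z) ∈ ω 1) ∧ z ≠ x ∧ t ≠ x := by
  have hs : JWιSide u v w z t x := by
    rcases hω.1 with h | h
    exacts [h.1, h.1]
  exact ⟨hs, (mem_lineCls_one_iff u w 0 ω).1 hω.2.1, (mem_lineCls_one_iff t z 1 ω).1 hω.2.2,
    ne_and_ne_of_side_of_mem_lineCls hs (by decide) hω.2.2⟩

end IotaCls11

open IotaCls11
open IotaCls12 (l0B l0Iw l0Ie isFinitary_l0B isFinitary_l0Iw isFinitary_l0Ie piPerc_eq_zero_of_not_adj)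

section

variable (p : unitInterval)

/-- **Class `(1,1)`, `u = e_ι`**: only part `II` is live; start `{0 ←2→ w} ∘ {w ←1̲→ e_ι} ≤ P^{ι,1}(e_ι,w)`.
[cite: FitznerVanDerHofstad2017, §6.1 proof of Lemma 5.3, Case a = 1 with `u = e_ι`, "b = 1" (arXiv:1506.07977v2 p. 59); App. B `Ā^{ι,1,1}` (pp. 75, 78)] -/
theorem jointWitIota_cls_one_one_of_eq {ι : Fin d × Bool} {u : Site d} (hu : u = stepVec ι) (x v w z t : Site d) :
    ENNReal.ofReal (bondJ d p (v - u)) * piPerc d p 2 (jointWitIota ι x u v w z t ∩ clsSet u w t z 1 1) ≤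
      ∑ κ : Fin d × Bool, (if v = u + stepVec κ then (1 : ℝ≥0∞) else 0) *
        (blockPiota (Letters.perc d p) ι 1 u w * blockAbar' (Letters.perc d p) κ 1 1 u w t z *
          blockPE (Letters.perc d p) 1 (t - x) (z - x)) := by
  classical
  refine ofReal_bondJ_mul_le_sum_ite p u v _ _ fun κ hv => ?_
  by_cases hne : (jointWitIota ι x u v w z t ∩ clsSet u w t z 1 1).Nonempty
  swap
  · rw [Set.not_nonempty_iff_eq_empty.1 hne, measure_empty, mul_zero]; exact zero_le
  obtain ⟨ω₀, hω₀⟩ := hne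
  obtain ⟨hs, -, ⟨htz, -⟩, hzx, htx⟩ := facts hω₀
  have huv : u ≠ v := (adj_of_eq_add_stepVec hv).ne
  have htu : t ≠ u := hs.2.2.2.2.1
  have hzu : z ≠ u := hs.2.2.2.2.2.1
  rw [jointWitIota_inter_eq_of_I (jointWitIotaI_inter_clsSet_eq_empty_of_eq hu x v w z t (a := 1) (by decide) 1)]
  subst hu
  -- the class bonds must be lattice bonds
  by_cases hadjw : (zdGraph d).Adj (stepVec ι) w
  swap
  · rw [piPerc_eq_zero_of_not_adj p (fun ω hω => ((mem_lineCls_one_iff _ w 0 ω).1 hω.2.1).2) hadjw, mul_zero]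
    exact zero_le
  obtain ⟨κ', hw⟩ := (zdGraph_adj_iff_stepVec (stepVec ι) w).1 hadjw
  by_cases hadjt : (zdGraph d).Adj t z
  swap
  · rw [piPerc_eq_zero_of_not_adj₁ p (fun ω hω => ((mem_lineCls_one_iff t z 1 ω).1 hω.2.2).2) hadjt, mul_zero]
    exact zero_le
  -- the row of the `Ā`-table
  have htwo : twoDD (w - stepVec ι) = 1 := by rw [hw, add_sub_cancel_left, twoDD_stepVec]
  have hA : blockAbar' (Letters.perc d p) κ 1 1 (stepVec ι) w t z = (ENNReal.ofReal p)⁻¹ *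
      (Letters.perc d p).S (eq 1) (ge 0) (eq 1) (ge 0) (v - stepVec ι) (t - stepVec ι) (z - stepVec ι)
        (w - stepVec ι) := by
    rw [Cls11.blockAbar'_one_one, htwo, one_mul, hv, add_sub_cancel_left]; rfl
  rw [hA]
  refine ofReal_mul_le_of_absorb_two ?_
  have hB : MeasurableSet (jointWitIotaII ι x (stepVec ι) v w z t ∩ clsSet (stepVec ι) w t z 1 1) :=
    (measurableSet_jointWitIotaII ι x (stepVec ι) v w z t).inter (measurableSet_clsSet (stepVec ι) w t z 1 1)
  rw [ofReal_mul_piPerc_eq_inter_of_preimage p hv hB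
      (eraseAt0_preimage_jointWitIotaII_inter_clsSet ι x (stepVec ι) v w z t 1 1),
    ofReal_mul_piPerc_eq_inter_tz p hadjt hB (eraseAt0_tz_preimage_jointWitIotaII_inter_cls₁ ι x (stepVec ι) v w z t 1)]
  have h3 := piPerc_inter_le_prod₃_of_witnessedι₀₁ p
    (E := jointWitIotaII ι x (stepVec ι) v w z t ∩ clsSet (stepVec ι) w t z 1 1) (C := clsSet (stepVec ι) w t z 1 1)
    (fun ω hω => jointWitnessedι_pinII_of_mem hω.1 ((mem_lineCls_one_iff _ w 0 ω).1 hω.2.1).2)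
    IotaB1.cls₁_facts htu hzu
    (IotaB1.mk (l0B (stepVec ι) w z) (stepVec ι) v t z x) (IotaB1.isFinitary_mk (isFinitary_l0B _ w z) _ v t z x)
    grpιII₀₁ grpιII₀₁_adm
    (fun ω hω hlat i K hK _ hL hI _ => by
      have hcl := (mem_lineCls_one_iff (stepVec ι) w 0 ω).1 hω.2.1
      have hw0 : w ≠ 0 := (eq_and_ne_zero_of_mem_II_cls_one hω.1).2
      have hwe : w ≠ stepVec ι := (sideII_of_mem hω.1.1).2.1
      fin_cases i
      · -- `{0 ↔ w}` avoiding `(e,w)`: `|w| = 2` by parity, so `{0 ←2→ w}`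
        have hL' : K ∈ (openConn (0 : Site d) w : Set (BondConfig (Site d))) ∧ s(stepVec ι, w) ∉ K := hL
        exact mem_openConnGe_two_of_notMem hL'.1 hw0.symm fun h0w =>
          not_adj_of_adj_adj (adj_zero_stepVec' ι) ((SimpleGraph.mem_edgeSet _).1 (hlat hcl.2))
            ((SimpleGraph.mem_edgeSet _).1 (hlat (hK h0w)))
      · -- the bond
        have hL' : K = {s(stepVec ι, w)} := hL
        rw [hL']
        exact mem_openConnEq_one_of_mem hwe (Set.mem_singleton_iff.2 Sym2.eq_swap)
      · have hL' : K = ∅ := hL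
        rw [hL']
        exact mem_openConnGe_zero_of_mem
          (show (openGraph (∅ : BondConfig (Site d))).Reachable (stepVec ι) (stepVec ι) from .refl _)
      · have hL' : K = ∅ := hL
        rw [hL']
        exact mem_openConnGe_zero_of_mem
          (show (openGraph (∅ : BondConfig (Site d))).Reachable (stepVec ι) (stepVec ι) from .refl _)
      · have hL' : K ∈ (openConn w z : Set (BondConfig (Site d))) ∧ s(stepVec ι, w) ∉ K := hL
        exact mem_openConnGe_zero_of_mem (SimpleGraph.Reachable.symm hL'.1))
    (mem_openConnEq_one_of_mem huv (Set.mem_singleton _)) (mem_openConnEq_one_of_mem htz (Set.mem_singleton _))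
    (IotaB1.up₁ hzx htx)
  rw [Set.inter_assoc, Set.inter_self] at h3
  refine h3.trans (mul_le_mul' (mul_le_mul' ?_ ?_) ?_)
  · exact piPerc_grp_le _ _ _ 0 ![Sum.inl (Sum.inl 0), Sum.inl (Sum.inl 1)] (by decide) (by decide)
      (by funext m; fin_cases m <;> rfl) (piPerc_iotaStart_one_base_le_blockPiota p ι w _)
  · exact piPerc_grp_le _ _ _ 1 ![Sum.inl (Sum.inr 0), Sum.inr 0, Sum.inl (Sum.inr 1), Sum.inl (Sum.inl 4)]
      (by decide) (by decide) (by funext m; fin_cases m <;> rfl) (piPerc_mid_b1_le_S p (stepVec ι) v t z w _)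
  · exact piPerc_grp_le _ _ _ 2 ![Sum.inr 2, Sum.inr 1, Sum.inr 3] (by decide) (by decide)
      (by funext m; fin_cases m <;> rfl) (piPerc_end_one_le_blockPE p htx hzx _)

/-- **Class `(1,1)`, `u ≠ e_ι`**: only part `I` is live (clause C1); after re-routing onto the open bond `(u,w)` the
start is `P^{ι,1}(u,w)` (rows `one_eq` for `w = e_ι`, `one_ne` for `w ≠ e_ι`).
[cite: FitznerVanDerHofstad2017, §6.1 proof of Lemma 5.3, Case a = 1 with `u ≠ e_ι`, "b = 1"; App. B rows b=1 of P^{ι,b}, `Ā^{ι,1,1}` (arXiv:1506.07977v2 pp. 59, 73, 75, 78)] -/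
theorem jointWitIota_cls_one_one_of_ne {ι : Fin d × Bool} {u : Site d} (hu : u ≠ stepVec ι) (x v w z t : Site d) :
    ENNReal.ofReal (bondJ d p (v - u)) * piPerc d p 2 (jointWitIota ι x u v w z t ∩ clsSet u w t z 1 1) ≤
      ∑ κ : Fin d × Bool, (if v = u + stepVec κ then (1 : ℝ≥0∞) else 0) *
        (blockPiota (Letters.perc d p) ι 1 u w * blockAbar' (Letters.perc d p) κ 1 1 u w t z *
          blockPE (Letters.perc d p) 1 (t - x) (z - x)) := by
  classical
  refine ofReal_bondJ_mul_le_sum_ite p u v _ _ fun κ hv => ?_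
  by_cases hne : (jointWitIota ι x u v w z t ∩ clsSet u w t z 1 1).Nonempty
  swap
  · rw [Set.not_nonempty_iff_eq_empty.1 hne, measure_empty, mul_zero]; exact zero_le
  obtain ⟨ω₀, hω₀⟩ := hne
  obtain ⟨hs, ⟨huw, -⟩, ⟨htz, -⟩, hzx, htx⟩ := facts hω₀
  have huv : u ≠ v := (adj_of_eq_add_stepVec hv).ne
  have htu : t ≠ u := hs.2.2.2.2.1
  have hzu : z ≠ u := hs.2.2.2.2.2.1
  rw [jointWitIota_inter_eq_of_II (jointWitIotaII_inter_clsSet_one_eq_empty_of_ne hu x v w z t 1)]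
  -- the class bonds must be lattice bonds
  by_cases hadjw : (zdGraph d).Adj u w
  swap
  · rw [piPerc_eq_zero_of_not_adj p (fun ω hω => ((mem_lineCls_one_iff u w 0 ω).1 hω.2.1).2) hadjw, mul_zero]
    exact zero_le
  obtain ⟨κ', hw⟩ := (zdGraph_adj_iff_stepVec u w).1 hadjw
  by_cases hadjt : (zdGraph d).Adj t z
  swap
  · rw [piPerc_eq_zero_of_not_adj₁ p (fun ω hω => ((mem_lineCls_one_iff t z 1 ω).1 hω.2.2).2) hadjt, mul_zero]
    exact zero_le
  -- the row of the `Ā`-table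
  have htwo : twoDD (w - u) = 1 := by rw [hw, add_sub_cancel_left, twoDD_stepVec]
  have hA : blockAbar' (Letters.perc d p) κ 1 1 u w t z = (ENNReal.ofReal p)⁻¹ *
      (Letters.perc d p).S (eq 1) (ge 0) (eq 1) (ge 0) (v - u) (t - u) (z - u) (w - u) := by
    rw [Cls11.blockAbar'_one_one, htwo, one_mul, hv, add_sub_cancel_left]; rfl
  rw [hA]
  refine ofReal_mul_le_of_absorb_two ?_
  have hB : MeasurableSet (jointWitIotaI ι x u v w z t ∩ clsSet u w t z 1 1) :=
    (measurableSet_jointWitIotaI ι x u v w z t).inter (measurableSet_clsSet u w t z 1 1)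
  rw [ofReal_mul_piPerc_eq_inter_of_preimage p hv hB (eraseAt0_preimage_jointWitIotaI_inter_clsSet ι x u v w z t 1 1),
    ofReal_mul_piPerc_eq_inter_tz p hadjt hB (eraseAt0_tz_preimage_jointWitIotaI_inter_cls₁ ι x u v w z t 1)]
  have hE : ∀ ω ∈ jointWitIotaI ι x u v w z t ∩ clsSet u w t z 1 1,
      JointWitnessedι (jwιLinesIpin (stepVec ι) u w z) {3} s((0 : Site d), stepVec ι) z v t x
        (offBonds {s(u, v)} (ω 0)) (offBonds (bondsAt {u}) (ω 1)) :=
    fun ω hω => jointWitnessedι_pinI_of_mem hu hω.1 ((mem_lineCls_one_iff u w 0 ω).1 hω.2.1).2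
  by_cases hwe : w = stepVec ι
  · -- `w = e_ι`: `{0 ←3→ e}, {e ←3→ u}` (the avoiding `{e↔u}` witness, parity) and the bond `{u ←1̲→ e}`
    subst hwe
    have h3 := piPerc_inter_le_prod₃_of_witnessedι₀₁ p
      (E := jointWitIotaI ι x u v (stepVec ι) z t ∩ clsSet u (stepVec ι) t z 1 1) (C := clsSet u (stepVec ι) t z 1 1)
      hE IotaB1.cls₁_facts htu hzu (IotaB1.mk (l0Ie (stepVec ι) u z) u v t z x)
      (IotaB1.isFinitary_mk (isFinitary_l0Ie _ u z) u v t z x) grpιI₀₁ grpιI₀₁_adm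
      (fun ω hω hlat i K hK _ hL hI _ => by
        fin_cases i
        · have hL' : K ∈ (openConn (0 : Site d) (stepVec ι) : Set (BondConfig (Site d))) ∧
            s(u, stepVec ι) ∉ K := hL
          exact mem_event_ge_three_zero_stepVec hlat hK hL'.1 (hI (by decide))
        · have hL' : K ∈ (openConn (stepVec ι) (stepVec ι) : Set (BondConfig (Site d))) ∧
            s(u, stepVec ι) ∉ K := hL
          exact mem_openConnGe_zero_of_mem hL'.1
        · have hL' : K = {s(u, stepVec ι)} := hL
          rw [hL']
          exact mem_openConnEq_one_of_mem hu (Set.mem_singleton _)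
        · have hL' : K ∈ (openConn (stepVec ι) z : Set (BondConfig (Site d))) ∧ s(u, stepVec ι) ∉ K := hL
          exact mem_openConnGe_zero_of_mem (SimpleGraph.Reachable.symm hL'.1)
        · have hL' : K ∈ (openConn (stepVec ι) u : Set (BondConfig (Site d))) ∧ s(u, stepVec ι) ∉ K := hL
          exact mem_openConnGe_three_of_notMem (hK.trans hlat) hadjw.symm hL'.1
            (by rw [Sym2.eq_swap]; exact hL'.2))
      (mem_openConnEq_one_of_mem huv (Set.mem_singleton _)) (mem_openConnEq_one_of_mem htz (Set.mem_singleton _))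
      (IotaB1.up₁ hzx htx)
    rw [Set.inter_assoc, Set.inter_self] at h3
    refine h3.trans (mul_le_mul' (mul_le_mul' ?_ ?_) ?_)
    · exact piPerc_grp_le _ _ _ 0 ![Sum.inl (Sum.inl 0), Sum.inl (Sum.inl 4), Sum.inl (Sum.inl 2)] (by decide)
        (by decide) (by funext m; fin_cases m <;> rfl) (piPerc_iotaStart_one_eq_le_blockPiota p ι u _)
    · exact piPerc_grp_le _ _ _ 1 ![Sum.inl (Sum.inr 0), Sum.inr 0, Sum.inl (Sum.inr 1), Sum.inl (Sum.inl 3)]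
        (by decide) (by decide) (by funext m; fin_cases m <;> rfl) (piPerc_mid_b1_le_S p u v t z (stepVec ι) _)
    · exact piPerc_grp_le _ _ _ 2 ![Sum.inr 2, Sum.inr 1, Sum.inr 3] (by decide) (by decide)
        (by funext m; fin_cases m <;> rfl) (piPerc_end_one_le_blockPE p htx hzx _)
  · -- `w ≠ e_ι`: `{0 ←3→ e}` and the triangle `{e ←1→ w}, {w ←1̲→ u}, {u ←1→ e}`
    have h3 := piPerc_inter_le_prod₃_of_witnessedι₀₁ p
      (E := jointWitIotaI ι x u v w z t ∩ clsSet u w t z 1 1) (C := clsSet u w t z 1 1)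
      hE IotaB1.cls₁_facts htu hzu (IotaB1.mk (l0Iw (stepVec ι) u w z) u v t z x)
      (IotaB1.isFinitary_mk (isFinitary_l0Iw _ u w z) u v t z x) grpιI₀₁ grpιI₀₁_adm
      (fun ω hω hlat i K hK _ hL hI _ => by
        fin_cases i
        · have hL' : K ∈ (openConn (0 : Site d) (stepVec ι) : Set (BondConfig (Site d))) ∧ s(u, w) ∉ K := hL
          exact mem_event_ge_three_zero_stepVec hlat hK hL'.1 (hI (by decide))
        · have hL' : K ∈ (openConn (stepVec ι) w : Set (BondConfig (Site d))) ∧ s(u, w) ∉ K := hL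
          exact mem_openConnGe_one_of_ne hL'.1 (Ne.symm hwe)
        · have hL' : K = {s(u, w)} := hL
          rw [hL']
          exact mem_openConnEq_one_of_mem (Ne.symm huw) (Set.mem_singleton_iff.2 Sym2.eq_swap)
        · have hL' : K ∈ (openConn w z : Set (BondConfig (Site d))) ∧ s(u, w) ∉ K := hL
          exact mem_openConnGe_zero_of_mem (SimpleGraph.Reachable.symm hL'.1)
        · have hL' : K ∈ (openConn (stepVec ι) u : Set (BondConfig (Site d))) ∧ s(u, w) ∉ K := hL
          exact mem_openConnGe_one_of_ne (SimpleGraph.Reachable.symm hL'.1) hu)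
      (mem_openConnEq_one_of_mem huv (Set.mem_singleton _)) (mem_openConnEq_one_of_mem htz (Set.mem_singleton _))
      (IotaB1.up₁ hzx htx)
    rw [Set.inter_assoc, Set.inter_self] at h3
    refine h3.trans (mul_le_mul' (mul_le_mul' ?_ ?_) ?_)
    · exact piPerc_grp_le _ _ _ 0
        ![Sum.inl (Sum.inl 0), Sum.inl (Sum.inl 1), Sum.inl (Sum.inl 2), Sum.inl (Sum.inl 4)] (by decide)
        (by decide) (by funext m; fin_cases m <;> rfl) (piPerc_iotaStart_one_ne_le_blockPiota p ι u w _)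
    · exact piPerc_grp_le _ _ _ 1 ![Sum.inl (Sum.inr 0), Sum.inr 0, Sum.inl (Sum.inr 1), Sum.inl (Sum.inl 3)]
        (by decide) (by decide) (by funext m; fin_cases m <;> rfl) (piPerc_mid_b1_le_S p u v t z w _)
    · exact piPerc_grp_le _ _ _ 2 ![Sum.inr 2, Sum.inr 1, Sum.inr 3] (by decide) (by decide)
        (by funext m; fin_cases m <;> rfl) (piPerc_end_one_le_blockPE p htx hzx _)

/-- **The class `(a,b) = (1,1)` of (6.4) at `N = 1` for the `ι`-event** — the cell `h2 (1,1)` of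
`NobleBoundsN1IotaReduce.tsum_ofReal_nobleXiIotaN_one_le_of_cls₁₂` with `E ι x := jointWitIota ι x`.
[cite: FitznerVanDerHofstad2017, §6.1 proof of Lemma 5.3, (6.4) class (a,b) = (1,1) (arXiv:1506.07977v2 pp. 58–59)] -/
theorem jointWitIota_cls_one_one (ι : Fin d × Bool) (x u v w z t : Site d) :
    ENNReal.ofReal (bondJ d p (v - u)) * piPerc d p 2 (jointWitIota ι x u v w z t ∩ clsSet u w t z 1 1) ≤
      ∑ κ : Fin d × Bool, (if v = u + stepVec κ then (1 : ℝ≥0∞) else 0) *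
        (blockPiota (Letters.perc d p) ι 1 u w * blockAbar' (Letters.perc d p) κ 1 1 u w t z *
          blockPE (Letters.perc d p) 1 (t - x) (z - x)) := by
  by_cases hu : u = stepVec ι
  exacts [jointWitIota_cls_one_one_of_eq p hu x v w z t, jointWitIota_cls_one_one_of_ne p hu x v w z t]

end

end Literature.Probability.FitznerVanDerHofstad2017
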